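import Literature.Analysis.FunctionSpaces.FlatTorusProofs
import Literature.Analysis.FunctionSpaces.TorusCalculusProofs
import Literature.Analysis.FunctionSpaces.MinkowskiIntegral
import Literature.Analysis.FunctionSpaces.PoincareWirtingerConvex
import Mathlib.MeasureTheory.Function.LpSeminorm.CompareExp
import Mathlib.Analysis.SpecialFunctions.Integrals.Basic
import HarnessLib

/-!
# The mean-value formula, the Poincaré–Wirtinger inequality in `L^p` and Morrey's inequality
  on the flat torus `T^d`

Analysis/FunctionSpaces support file (everything proved; no definitions, no named facts). It
serves the discharge of Cheskidov–Luo 2022, Thm. 7.3 (`Literature.Analysis.FluidPDE.Torus.antidivergence_Lp_bound`,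
the `L^p` bound, `1 ≤ p ≤ ∞`, of the De Lellis–Székelyhidi antidivergence), whose printed proof
uses "the boundedness of the Riesz transforms and the Poincaré inequality" for `1 < p < ∞` and
"the Sobolev embedding `W^{1,d+1}(𝕋^d) ↪ L^∞(𝕋^d)`" for `p = ∞`. The Riesz-transform input is the
tree's `Torus.eLpNorm_hessian_le_laplacian_holds` (`TorusRieszTransformProofs`); this file supplies
the two embedding inequalities, for `C¹` maps `f : T^d → F` into a real Banach space:

* `Torus.sub_integral_eq_setIntegral_unitCube` — the **mean-value formula**
  `f x - ∫ f = ∫_{y ∈ [0,1)^d} (f x - f (x + π y)) dy` (`π = Torus.proj`; translation invariance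
  of Haar measure and `Torus.measurePreserving_proj_unitCube`), together with the segment form of
  the fundamental theorem of calculus `f (x + π y) - f x = ∫₀¹ Df(x + π(ty)) y dt`
  (`Torus.sub_eq_integral_fderiv_segment`);
* `Torus.eLpNorm_sub_integral_le` — **Poincaré–Wirtinger in `L^p`, `1 ≤ p < ∞`**:
  `‖f - ∫ f‖_{L^p(T^d)} ≤ d · ‖Df‖_{L^p(T^d)}` (Minkowski's integral inequality,
  `Literature.Analysis.FunctionSpaces.eLpNorm_integral_le_lintegral_eLpNorm`, applied twice to the
  mean-value formula, and translation invariance of the `L^p` norm);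
* `Torus.enorm_sub_integral_le` — **Morrey's inequality**, `q > d`:
  `‖f x - ∫ f‖ ≤ d · q/(q-d) · ‖Df‖_{L^q(T^d)}` for every `x` (in the mean-value formula,
  `∫_{[0,1)^d} ‖Df(x + π(ty))‖ dy = t^{-d} ∫_{t[0,1)^d} ‖Df(x + π z)‖ dz ≤ t^{-d/q} ‖Df‖_{L^q}` by
  Hölder, and `∫₀¹ t^{-d/q} dt = q/(q-d)`);
* `Torus.eLpNorm_norm_fderiv_le_sum` — the operator norm of `Df(x)` against the partial
  derivatives, `‖Df‖_{L^p} ≤ Σⱼ ‖∂ⱼf‖_{L^p}`.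

Constants are not optimised (`d` stands in for `diam [0,1]^d = √d`).

## Mathlib / tree search

Mathlib (this pin) has the Gagliardo–Nirenberg–Sobolev inequality on `ℝⁿ`
(`MeasureTheory.eLpNorm_le_eLpNorm_fderiv_of_eq`, `1 ≤ p < n`) but neither Morrey's inequality
(`p > n`) nor a Poincaré–Wirtinger inequality (searched `morrey`, `poincare`, `Wirtinger`: nothing
relevant); on the torus it has no Sobolev inequalities at all. Tree: `PoincareWirtingerConvex`
(the `L²` Poincaré–Wirtinger inequality on convex subsets of `ℝⁿ` by the same segment argument;
its homothety lemma `lintegral_comp_smul` is reused here), `SobolevDomainPoincareProofs` /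
`SobolevTracePoincareProofs` (bounded domains of `ℝⁿ`, `W^{1,p}` classes), `TorusCellAverages`
(`L²` on lattice cells). Nothing for `L^p(T^d)`, `p ≠ 2`, or for the sup norm.

## References

* L. C. Evans, *Partial Differential Equations*, 2nd ed. (2010), §5.6.2 Thm. 4 (Morrey's
  inequality) and §5.8.1 Thm. 1 (Poincaré's inequality), both by the segment/mean-value argument.
* D. Gilbarg, N. Trudinger, *Elliptic PDE of Second Order* (2001), Lemma 7.16 and (7.45)
  (mean-value representation on convex domains and the Poincaré inequality it implies).
* A. Cheskidov, X. Luo, Invent. Math. 229 (2022) = arXiv:2009.06596, §7.2, proof of Thm. 7.3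
  (consumer). [`CheskidovLuo2022`]
-/

noncomputable section

open MeasureTheory Set Filter Function
open scoped ENNReal NNReal ContDiff Pointwise

namespace Literature.Analysis.FunctionSpaces

namespace Torus

variable {d : Type*} [Fintype d]
variable {F : Type*} [NormedAddCommGroup F] [NormedSpace ℝ F]

/-! ## Preliminaries: the unit cube, continuity of `Df`, the operator norm of `Df` -/

section Prelim

/-- Points of the unit cube have norm at most `d` (crude: `0 ≤ yᵢ < 1` for every `i`, so
`‖y‖ ≤ √d ≤ d`; twin of `Torus.norm_le_card_of_mem_unitCube` in `TorusPeriodization`, not imported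
here). [folklore] -/
private theorem norm_le_card_of_mem_unitCube' {y : EuclideanSpace ℝ d} (hy : y ∈ unitCube d) :
    ‖y‖ ≤ Fintype.card d := by
  rw [EuclideanSpace.norm_eq]
  have h1 : ∑ i, ‖y i‖ ^ 2 ≤ (Fintype.card d : ℝ) := by
    calc ∑ i, ‖y i‖ ^ 2 ≤ ∑ _i : d, (1 : ℝ) := Finset.sum_le_sum fun i _ => by
          rw [Real.norm_eq_abs, abs_of_nonneg (hy i).1, sq_le_one_iff₀ (hy i).1]
          exact (hy i).2.le
      _ = (Fintype.card d : ℝ) := by simp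
  have h2 : (Fintype.card d : ℝ) ≤ (Fintype.card d : ℝ) ^ 2 := by
    exact_mod_cast Nat.le_self_pow two_ne_zero (Fintype.card d)
  exact (Real.sqrt_le_sqrt h1).trans (Real.sqrt_le_iff.2 ⟨by positivity, h2⟩)

/-- The unit cube has Lebesgue measure `1` (it is carried onto the probability space `T^d` by the
measure-preserving covering map; private copy of `Torus.volume_unitCube` of
`TorusGridCellsGeometry`, not imported here). [folklore] -/
private theorem volume_unitCube_eq_one : volume (unitCube d) = 1 := by
  have hmp : MeasurePreserving proj (volume.restrict (unitCube d)) volume :=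
    measurePreserving_proj_unitCube_holds
  have h := hmp.measure_preimage (MeasurableSet.univ (α := UnitAddTorus d)).nullMeasurableSet
  rwa [preimage_univ, Measure.restrict_apply_univ, measure_univ] at h

omit [Fintype d] in
/-- The scaled cubes `t • [0,1)^d`, `0 < t ≤ 1`, lie in the unit cube. [folklore] -/
theorem smul_unitCube_subset {t : ℝ} (ht0 : 0 < t) (ht1 : t ≤ 1) : t • unitCube d ⊆ unitCube d := by
  intro z hz
  obtain ⟨y, hy, rfl⟩ := Set.mem_smul_set.1 hz
  intro i
  have hyi := hy i
  refine ⟨?_, ?_⟩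
  · simp only [PiLp.smul_apply, smul_eq_mul]
    exact mul_nonneg ht0.le hyi.1
  · simp only [PiLp.smul_apply, smul_eq_mul]
    calc t * y i < t * 1 := mul_lt_mul_of_pos_left hyi.2 ht0
      _ ≤ 1 := by rw [mul_one]; exact ht1

/-- The torus derivative `Df : T^d → (ℝ^d →L F)` of a `C¹` map is continuous (private copy of
`Torus.IsContDiff.continuous_fderiv` of `TorusConvolution`, not imported here). [folklore] -/
private theorem continuous_torusFderiv_of_isContDiff {f : UnitAddTorus d → F} (hf : IsContDiff 1 f) :
    Continuous (Torus.fderiv f) := by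
  have h : lift (Torus.fderiv f) = _root_.fderiv ℝ (lift f) := funext fun y => (fderiv_lift f y).symm
  rw [← continuous_lift_iff, h]
  exact ContDiff.continuous_fderiv hf one_ne_zero

/-- **The operator norm of `Df(x)` is at most the sum of the norms of the partial derivatives**:
`Df(x) w = Σⱼ wⱼ ∂ⱼf(x)` and `|wⱼ| ≤ ‖w‖` (private copy of
`Torus.norm_fderiv_le_sum_norm_partialDeriv` of `LadyzhenskayaTorus`, not imported here). [folklore] -/
private theorem norm_torusFderiv_le_sum_norm_partialDeriv [DecidableEq d] {f : UnitAddTorus d → F}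
    (hf : IsContDiff 1 f) (x : UnitAddTorus d) :
    ‖Torus.fderiv f x‖ ≤ ∑ j, ‖partialDeriv j f x‖ := by
  refine ContinuousLinearMap.opNorm_le_bound _ (Finset.sum_nonneg fun j _ => norm_nonneg _) fun w => ?_
  rw [fderiv_apply_eq_sum_partialDeriv hf x w, Finset.sum_mul]
  refine (norm_sum_le _ _).trans (Finset.sum_le_sum fun j _ => ?_)
  rw [norm_smul, mul_comm]
  exact mul_le_mul_of_nonneg_left ((Real.norm_eq_abs _).le.trans
    ((Real.norm_eq_abs _).symm.le.trans (PiLp.norm_apply_le w j))) (norm_nonneg _)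

/-- `‖Df‖_{L^p} ≤ Σⱼ ‖∂ⱼ f‖_{L^p}` for `C¹` maps on the torus. [folklore] -/
theorem eLpNorm_norm_fderiv_le_sum [DecidableEq d] {f : UnitAddTorus d → F} (hf : IsContDiff 1 f)
    {p : ℝ≥0∞} (hp : 1 ≤ p) :
    eLpNorm (fun x => ‖Torus.fderiv f x‖) p volume ≤ ∑ j, eLpNorm (partialDeriv j f) p volume := by
  have hmeas : ∀ j, AEStronglyMeasurable (fun x => ‖partialDeriv j f x‖) volume := by
    intro j
    have hc : Continuous (partialDeriv j f) := by
      have : partialDeriv j f = fun x => Torus.fderiv f x (EuclideanSpace.single j 1) :=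
        funext fun x => partialDeriv_eq_fderiv_apply hf j x
      rw [this]
      exact (continuous_torusFderiv_of_isContDiff hf).clm_apply continuous_const
    exact hc.norm.aestronglyMeasurable
  calc eLpNorm (fun x => ‖Torus.fderiv f x‖) p volume
      ≤ eLpNorm (fun x => ∑ j, ‖partialDeriv j f x‖) p volume := by
        refine eLpNorm_mono_real fun x => ?_
        rw [norm_norm]
        exact norm_torusFderiv_le_sum_norm_partialDeriv hf x
    _ = eLpNorm (∑ j, fun x => ‖partialDeriv j f x‖) p volume := by rw [← Finset.sum_fn]
    _ ≤ ∑ j, eLpNorm (fun x => ‖partialDeriv j f x‖) p volume := eLpNorm_sum_le (fun j _ => hmeas j) hp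
    _ = ∑ j, eLpNorm (partialDeriv j f) p volume := Finset.sum_congr rfl fun j _ => eLpNorm_norm _

end Prelim

/-! ## The mean-value formula -/

section MeanValue

variable [CompleteSpace F]

/-- **Fundamental theorem of calculus along a segment on the torus**: for `C¹` `f`,
`f (x + π y) - f x = ∫₀¹ Df(x + π(t y)) y dt`. [folklore] -/
theorem sub_eq_integral_fderiv_segment {f : UnitAddTorus d → F} (hf : IsContDiff 1 f)
    (x : UnitAddTorus d) (y : EuclideanSpace ℝ d) :
    f (x + proj y) - f x = ∫ t in (0 : ℝ)..1, Torus.fderiv f (x + proj (t • y)) y := by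
  have hderiv : ∀ s : ℝ, HasDerivAt (fun s : ℝ => f (x + proj (s • y)))
      (Torus.fderiv f (x + proj (s • y)) y) s := by
    intro s
    have h := hasDerivAt_comp_add_proj_smul hf x y s
    rwa [lineDeriv_eq_fderiv_apply hf] at h
  have hcont : Continuous fun s : ℝ => Torus.fderiv f (x + proj (s • y)) y :=
    ((continuous_torusFderiv_of_isContDiff hf).comp
      (continuous_const.add (continuous_proj.comp (continuous_id.smul continuous_const)))).clm_apply
      continuous_const
  have h := intervalIntegral.integral_eq_sub_of_hasDerivAt (fun s _ => hderiv s) (hcont.intervalIntegrable 0 1)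
  simp only [one_smul, zero_smul, proj_zero, add_zero] at h
  exact h.symm

omit [CompleteSpace F] in
/-- Averaging over the fundamental cube: `∫_{T^d} f = ∫_{y ∈ [0,1)^d} f (x + π y) dy` for
continuous `f` and every base point `x` (translation invariance of Haar measure and the
measure-preserving covering map `[0,1)^d → T^d`). [folklore] -/
theorem integral_eq_setIntegral_unitCube_comp_add {f : UnitAddTorus d → F} (hf : Continuous f)
    (x : UnitAddTorus d) : ∫ z, f z = ∫ y in unitCube d, f (x + proj y) := by
  have hmp : MeasurePreserving (fun y : EuclideanSpace ℝ d => x + proj y) (volume.restrict (unitCube d)) volume :=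
    (measurePreserving_add_left volume x).comp measurePreserving_proj_unitCube_holds
  calc ∫ z, f z = ∫ z, f z ∂(Measure.map (fun y : EuclideanSpace ℝ d => x + proj y) (volume.restrict (unitCube d))) := by
        rw [hmp.map_eq]
    _ = ∫ y in unitCube d, f (x + proj y) := integral_map hmp.measurable.aemeasurable hf.aestronglyMeasurable

/-- **The mean-value formula on the torus**: `f x - ∫ f = ∫_{y ∈ [0,1)^d} (f x - f (x + π y)) dy`
for continuous `f`. [folklore] -/
theorem sub_integral_eq_setIntegral_unitCube {f : UnitAddTorus d → F} (hf : Continuous f)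
    (x : UnitAddTorus d) : f x - ∫ z, f z = ∫ y in unitCube d, (f x - f (x + proj y)) := by
  have hmp : MeasurePreserving (fun y : EuclideanSpace ℝ d => x + proj y) (volume.restrict (unitCube d)) volume :=
    (measurePreserving_add_left volume x).comp measurePreserving_proj_unitCube_holds
  have hint : Integrable (fun y : EuclideanSpace ℝ d => f (x + proj y)) (volume.restrict (unitCube d)) :=
    (hmp.integrable_comp hf.aestronglyMeasurable).2 hf.integrable_unitAddTorus
  haveI : IsFiniteMeasure (volume.restrict (unitCube d) : Measure (EuclideanSpace ℝ d)) :=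
    ⟨by rw [Measure.restrict_apply_univ, volume_unitCube_eq_one]; exact ENNReal.one_lt_top⟩
  rw [integral_sub (integrable_const _) hint, integral_eq_setIntegral_unitCube_comp_add hf x,
    setIntegral_const, Measure.real, volume_unitCube_eq_one, ENNReal.toReal_one, one_smul]

end MeanValue

/-! ## The Poincaré–Wirtinger inequality in `L^p`, `1 ≤ p < ∞` -/

section Poincare

variable [CompleteSpace F]

/-- **Poincaré–Wirtinger on the torus, `1 ≤ p < ∞`**: `‖f - ∫ f‖_{L^p(T^d)} ≤ d ‖Df‖_{L^p(T^d)}`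
for `C¹` maps `f : T^d → F` (mean-value formula, Minkowski's integral inequality twice, and
translation invariance of the `L^p` norm; Evans 2010, §5.8.1). [folklore] -/
theorem eLpNorm_sub_integral_le {f : UnitAddTorus d → F} (hf : IsContDiff 1 f) {p : ℝ≥0∞}
    (hp1 : 1 ≤ p) (hp : p ≠ ⊤) :
    eLpNorm (fun x => f x - ∫ z, f z) p volume ≤
      (Fintype.card d : ℝ≥0∞) * eLpNorm (fun x => ‖Torus.fderiv f x‖) p volume := by
  set N := eLpNorm (fun x => ‖Torus.fderiv f x‖) p volume with hN
  have hfc : Continuous f := hf.continuous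
  have hDc : Continuous (Torus.fderiv f) := continuous_torusFderiv_of_isContDiff hf
  -- the mean-value formula and Minkowski over `y ∈ [0,1)^d`
  have h1 : (fun x => f x - ∫ z, f z) = fun x => ∫ y in unitCube d, (f x - f (x + proj y)) :=
    funext fun x => sub_integral_eq_setIntegral_unitCube hfc x
  have hF1 : AEStronglyMeasurable
      (uncurry fun (x : UnitAddTorus d) (y : EuclideanSpace ℝ d) => f x - f (x + proj y))
      ((volume : Measure (UnitAddTorus d)).prod (volume.restrict (unitCube d))) := by
    have hc : Continuous (uncurry fun (x : UnitAddTorus d) (y : EuclideanSpace ℝ d) => f x - f (x + proj y)) :=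
      (hfc.comp continuous_fst).sub (hfc.comp (continuous_fst.add (continuous_proj.comp continuous_snd)))
    exact hc.aestronglyMeasurable
  have h2 := eLpNorm_integral_le_lintegral_eLpNorm (μ := (volume : Measure (UnitAddTorus d)))
    (ν := volume.restrict (unitCube d)) hF1 hp1 hp
  -- for each `y`, the segment formula and Minkowski over `t ∈ (0,1]`
  have h3 : ∀ y ∈ unitCube d,
      eLpNorm (fun x => f x - f (x + proj y)) p volume ≤ (Fintype.card d : ℝ≥0∞) * N := by
    intro y hy
    have hseg : (fun x => f x - f (x + proj y)) =
        fun x => ∫ t in Ioc (0 : ℝ) 1, -(Torus.fderiv f (x + proj (t • y)) y) := by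
      funext x
      rw [integral_neg, ← intervalIntegral.integral_of_le zero_le_one,
        ← sub_eq_integral_fderiv_segment hf x y, neg_sub]
    have hF2 : AEStronglyMeasurable
        (uncurry fun (x : UnitAddTorus d) (t : ℝ) => -(Torus.fderiv f (x + proj (t • y)) y))
        ((volume : Measure (UnitAddTorus d)).prod (volume.restrict (Ioc (0 : ℝ) 1))) := by
      have hc : Continuous (uncurry fun (x : UnitAddTorus d) (t : ℝ) => -(Torus.fderiv f (x + proj (t • y)) y)) :=
        ((hDc.comp (continuous_fst.add (continuous_proj.comp (continuous_snd.smul continuous_const)))).clm_apply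
          continuous_const).neg
      exact hc.aestronglyMeasurable
    have h4 := eLpNorm_integral_le_lintegral_eLpNorm (μ := (volume : Measure (UnitAddTorus d)))
      (ν := volume.restrict (Ioc (0 : ℝ) 1)) hF2 hp1 hp
    have h5 : ∀ t : ℝ, eLpNorm (fun x => -(Torus.fderiv f (x + proj (t • y)) y)) p volume ≤ ‖y‖ₑ * N := by
      intro t
      have hmp : MeasurePreserving (fun x : UnitAddTorus d => x + proj (t • y)) volume volume :=
        measurePreserving_add_right volume (proj (t • y))
      have htr : eLpNorm (fun x => ‖Torus.fderiv f (x + proj (t • y))‖) p volume = N :=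
        eLpNorm_comp_measurePreserving (p := p) hDc.norm.aestronglyMeasurable hmp
      calc eLpNorm (fun x => -(Torus.fderiv f (x + proj (t • y)) y)) p volume
          ≤ eLpNorm (fun x => ‖y‖ * ‖Torus.fderiv f (x + proj (t • y))‖) p volume := by
            refine eLpNorm_mono_real fun x => ?_
            rw [norm_neg, mul_comm]
            exact (Torus.fderiv f (x + proj (t • y))).le_opNorm y
        _ = ‖y‖ₑ * N := by
            rw [← htr]
            have e : (fun x => ‖y‖ * ‖Torus.fderiv f (x + proj (t • y))‖) =
                ‖y‖ • fun x => ‖Torus.fderiv f (x + proj (t • y))‖ := rfl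
            rw [e, eLpNorm_const_smul, enorm_norm]
    have hy' : ‖y‖ₑ ≤ (Fintype.card d : ℝ≥0∞) := by
      rw [← ofReal_norm, ← ENNReal.ofReal_natCast]
      exact ENNReal.ofReal_le_ofReal (norm_le_card_of_mem_unitCube' hy)
    calc eLpNorm (fun x => f x - f (x + proj y)) p volume
        = eLpNorm (fun x => ∫ t in Ioc (0 : ℝ) 1, -(Torus.fderiv f (x + proj (t • y)) y)) p volume := by
          rw [hseg]
      _ ≤ ∫⁻ t in Ioc (0 : ℝ) 1, eLpNorm (fun x => -(Torus.fderiv f (x + proj (t • y)) y)) p volume := h4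
      _ ≤ ∫⁻ _t in Ioc (0 : ℝ) 1, ‖y‖ₑ * N := lintegral_mono fun t => h5 t
      _ = ‖y‖ₑ * N := by
          rw [setLIntegral_const, Real.volume_Ioc, sub_zero, ENNReal.ofReal_one, mul_one]
      _ ≤ (Fintype.card d : ℝ≥0∞) * N := mul_le_mul' hy' le_rfl
  calc eLpNorm (fun x => f x - ∫ z, f z) p volume
      = eLpNorm (fun x => ∫ y in unitCube d, (f x - f (x + proj y))) p volume := by rw [h1]
    _ ≤ ∫⁻ y in unitCube d, eLpNorm (fun x => f x - f (x + proj y)) p volume := h2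
    _ ≤ ∫⁻ _y in unitCube d, (Fintype.card d : ℝ≥0∞) * N :=
        setLIntegral_mono' measurableSet_unitCube fun y hy => h3 y hy
    _ = (Fintype.card d : ℝ≥0∞) * N := by rw [setLIntegral_const, volume_unitCube_eq_one, mul_one]

/-- **Poincaré–Wirtinger for zero-mean maps**: `‖f‖_{L^p(T^d)} ≤ d ‖Df‖_{L^p(T^d)}` when `∫ f = 0`,
`1 ≤ p < ∞`. [folklore] -/
theorem eLpNorm_le_of_hasZeroMean {f : UnitAddTorus d → F} (hf : IsContDiff 1 f) (h0 : HasZeroMean f)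
    {p : ℝ≥0∞} (hp1 : 1 ≤ p) (hp : p ≠ ⊤) :
    eLpNorm f p volume ≤ (Fintype.card d : ℝ≥0∞) * eLpNorm (fun x => ‖Torus.fderiv f x‖) p volume := by
  have h := eLpNorm_sub_integral_le hf hp1 hp
  have e : (fun x => f x - ∫ z, f z) = f := by
    funext x; rw [show (∫ z, f z) = 0 from h0, sub_zero]
  rwa [e] at h

end Poincare

/-! ## Morrey's inequality, `q > d` -/

section Morrey

variable [CompleteSpace F]

omit [CompleteSpace F] in
/-- The scaled-cube estimate behind Morrey's inequality: for `0 < t ≤ 1`, `1 ≤ q`, and a base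
point `x`, `∫_{[0,1)^d} ‖Df(x + π(t y))‖ dy ≤ t^{-d/q} ‖Df‖_{L^q(T^d)}` (substitute `z = t y`,
`t[0,1)^d ⊆ [0,1)^d` has measure `t^d`, Hölder). [folklore] -/
theorem setLIntegral_enorm_fderiv_comp_smul_le {f : UnitAddTorus d → F} (hf : IsContDiff 1 f)
    {q : ℝ} (hq1 : 1 ≤ q) (x : UnitAddTorus d) {t : ℝ} (ht0 : 0 < t) (ht1 : t ≤ 1) :
    ∫⁻ y in unitCube d, ‖Torus.fderiv f (x + proj (t • y))‖ₑ ≤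
      ENNReal.ofReal (t ^ (-((Fintype.card d : ℝ) / q))) *
        eLpNorm (fun z => ‖Torus.fderiv f z‖) (ENNReal.ofReal q) volume := by
  set n := Fintype.card d with hn
  set N := eLpNorm (fun z => ‖Torus.fderiv f z‖) (ENNReal.ofReal q) volume with hN
  have hq0 : 0 < q := lt_of_lt_of_le zero_lt_one hq1
  have hDc : Continuous (Torus.fderiv f) := continuous_torusFderiv_of_isContDiff hf
  set H : EuclideanSpace ℝ d → ℝ := fun z => ‖Torus.fderiv f (x + proj z)‖ with hH
  have hHc : Continuous H := (hDc.comp (continuous_const.add continuous_proj)).norm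
  have hHm : AEStronglyMeasurable H (volume.restrict (t • unitCube d)) := hHc.aestronglyMeasurable
  -- the substitution `z = t • y`
  have hmeasQ : MeasurableSet (t • unitCube d) := measurableSet_unitCube.const_smul₀ t
  have hind : ∀ y, (unitCube d).indicator (fun y => ‖H (t • y)‖ₑ) y =
      (t • unitCube d).indicator (fun z => ‖H z‖ₑ) (t • y) := by
    intro y
    by_cases hy : y ∈ unitCube d
    · rw [indicator_of_mem hy, indicator_of_mem (Set.smul_mem_smul_set hy)]
    · rw [indicator_of_notMem hy, indicator_of_notMem (mt (Set.smul_mem_smul_set_iff₀ ht0.ne' _ _).1 hy)]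
  have hsub : ∫⁻ y in unitCube d, ‖Torus.fderiv f (x + proj (t • y))‖ₑ =
      ENNReal.ofReal ((t ^ n)⁻¹) * ∫⁻ z in t • unitCube d, ‖H z‖ₑ := by
    have e1 : (fun y => ‖Torus.fderiv f (x + proj (t • y))‖ₑ) = fun y => ‖H (t • y)‖ₑ := by
      funext y; rw [hH]; dsimp only; rw [enorm_norm]
    rw [e1, ← lintegral_indicator measurableSet_unitCube, ← lintegral_indicator hmeasQ]
    simp_rw [hind]
    rw [lintegral_comp_smul volume ((t • unitCube d).indicator fun z => ‖H z‖ₑ) ht0.ne',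
      finrank_euclideanSpace, ← hn, abs_of_pos (inv_pos.2 (pow_pos ht0 n))]
  -- Hölder on `t • [0,1)^d`
  have hvol : (volume.restrict (t • unitCube d)) (univ : Set (EuclideanSpace ℝ d)) = ENNReal.ofReal (t ^ n) := by
    rw [Measure.restrict_apply_univ, Measure.addHaar_smul, volume_unitCube_eq_one, mul_one,
      finrank_euclideanSpace, ← hn, abs_of_pos (pow_pos ht0 n)]
  have hHolder : ∫⁻ z in t • unitCube d, ‖H z‖ₑ ≤ N * ENNReal.ofReal (t ^ n) ^ (1 - 1 / q) := by
    have h1 : ∫⁻ z in t • unitCube d, ‖H z‖ₑ = eLpNorm H 1 (volume.restrict (t • unitCube d)) := by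
      rw [eLpNorm_one_eq_lintegral_enorm]
    have h1q : (1 : ℝ≥0∞) ≤ ENNReal.ofReal q := by
      rw [← ENNReal.ofReal_one]; exact ENNReal.ofReal_le_ofReal hq1
    have h2 := eLpNorm_le_eLpNorm_mul_rpow_measure_univ h1q hHm
    rw [hvol, ENNReal.toReal_one, ENNReal.toReal_ofReal hq0.le, div_one] at h2
    have h3 : eLpNorm H (ENNReal.ofReal q) (volume.restrict (t • unitCube d)) ≤ N := by
      have hmono : eLpNorm H (ENNReal.ofReal q) (volume.restrict (t • unitCube d)) ≤
          eLpNorm H (ENNReal.ofReal q) (volume.restrict (unitCube d)) :=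
        eLpNorm_mono_measure H (Measure.restrict_mono (smul_unitCube_subset ht0 ht1) le_rfl)
      have hmpx : MeasurePreserving (fun z : EuclideanSpace ℝ d => x + proj z) (volume.restrict (unitCube d)) volume :=
        (measurePreserving_add_left volume x).comp measurePreserving_proj_unitCube_holds
      have heq : eLpNorm H (ENNReal.ofReal q) (volume.restrict (unitCube d)) = N :=
        eLpNorm_comp_measurePreserving (p := ENNReal.ofReal q) hDc.norm.aestronglyMeasurable hmpx
      exact hmono.trans heq.le
    rw [h1]
    exact h2.trans (mul_le_mul' h3 le_rfl)
  -- bookkeeping of the powers of `t`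
  have hpow : ENNReal.ofReal ((t ^ n)⁻¹) * (N * ENNReal.ofReal (t ^ n) ^ (1 - 1 / q)) =
      ENNReal.ofReal (t ^ (-((n : ℝ) / q))) * N := by
    have hT : 0 < t ^ n := pow_pos ht0 n
    rw [mul_comm N, ← mul_assoc, ENNReal.ofReal_rpow_of_pos hT, ← ENNReal.ofReal_mul (inv_pos.2 hT).le]
    congr 2
    rw [← Real.rpow_neg_one, ← Real.rpow_natCast, ← Real.rpow_mul ht0.le, ← Real.rpow_mul ht0.le,
      ← Real.rpow_add ht0]
    congr 1
    field_simp
    ring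
  calc ∫⁻ y in unitCube d, ‖Torus.fderiv f (x + proj (t • y))‖ₑ
      = ENNReal.ofReal ((t ^ n)⁻¹) * ∫⁻ z in t • unitCube d, ‖H z‖ₑ := hsub
    _ ≤ ENNReal.ofReal ((t ^ n)⁻¹) * (N * ENNReal.ofReal (t ^ n) ^ (1 - 1 / q)) := mul_le_mul' le_rfl hHolder
    _ = ENNReal.ofReal (t ^ (-((n : ℝ) / q))) * N := hpow

/-- **Morrey's inequality on the torus**: for `q > d` (and `q ≥ 1`) and `C¹` maps `f : T^d → F`,
`‖f x - ∫ f‖ ≤ d · q/(q-d) · ‖Df‖_{L^q(T^d)}` for every `x` — the Sobolev embedding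
`W^{1,q}(𝕋^d) ↪ L^∞(𝕋^d)` in quantitative form (Evans 2010, §5.6.2 Thm. 4, by the mean-value
formula). [folklore] -/
theorem enorm_sub_integral_le {f : UnitAddTorus d → F} (hf : IsContDiff 1 f) {q : ℝ} (hq1 : 1 ≤ q)
    (hq : (Fintype.card d : ℝ) < q) (x : UnitAddTorus d) :
    ‖f x - ∫ z, f z‖ₑ ≤ (Fintype.card d : ℝ≥0∞) * ENNReal.ofReal (q / (q - Fintype.card d)) *
      eLpNorm (fun z => ‖Torus.fderiv f z‖) (ENNReal.ofReal q) volume := by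
  set n := Fintype.card d with hn
  set N := eLpNorm (fun z => ‖Torus.fderiv f z‖) (ENNReal.ofReal q) volume with hN
  have hq0 : 0 < q := lt_of_lt_of_le zero_lt_one hq1
  have hfc : Continuous f := hf.continuous
  have hDc : Continuous (Torus.fderiv f) := continuous_torusFderiv_of_isContDiff hf
  set r : ℝ := -((n : ℝ) / q) with hr
  have hr1 : -1 < r := by
    rw [hr, neg_lt_neg_iff, div_lt_one hq0]; exact hq
  -- step 1: the mean-value formula, pointwise
  have hinner : ∀ y ∈ unitCube d, ‖f x - f (x + proj y)‖ₑ ≤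
      (n : ℝ≥0∞) * ∫⁻ t in Ioc (0 : ℝ) 1, ‖Torus.fderiv f (x + proj (t • y))‖ₑ := by
    intro y hy
    rw [← neg_sub, enorm_neg, sub_eq_integral_fderiv_segment hf x y, intervalIntegral.integral_of_le zero_le_one,
      ← lintegral_const_mul' _ _ (ENNReal.natCast_ne_top n)]
    refine (enorm_integral_le_lintegral_enorm _).trans (lintegral_mono fun t => ?_)
    rw [← ofReal_norm, ← ofReal_norm, ← ENNReal.ofReal_natCast,
      ← ENNReal.ofReal_mul (Nat.cast_nonneg n)]
    refine ENNReal.ofReal_le_ofReal ?_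
    calc ‖Torus.fderiv f (x + proj (t • y)) y‖ ≤ ‖Torus.fderiv f (x + proj (t • y))‖ * ‖y‖ :=
          (Torus.fderiv f (x + proj (t • y))).le_opNorm y
      _ ≤ ‖Torus.fderiv f (x + proj (t • y))‖ * n :=
          mul_le_mul_of_nonneg_left (norm_le_card_of_mem_unitCube' hy) (norm_nonneg _)
      _ = n * ‖Torus.fderiv f (x + proj (t • y))‖ := mul_comm _ _
  have h1 : ‖f x - ∫ z, f z‖ₑ ≤
      (n : ℝ≥0∞) * ∫⁻ y in unitCube d, ∫⁻ t in Ioc (0 : ℝ) 1, ‖Torus.fderiv f (x + proj (t • y))‖ₑ := by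
    rw [sub_integral_eq_setIntegral_unitCube hfc x, ← lintegral_const_mul' _ _ (ENNReal.natCast_ne_top n)]
    exact (enorm_integral_le_lintegral_enorm _).trans (setLIntegral_mono' measurableSet_unitCube hinner)
  -- step 2: Tonelli
  have hswap : ∫⁻ y in unitCube d, ∫⁻ t in Ioc (0 : ℝ) 1, ‖Torus.fderiv f (x + proj (t • y))‖ₑ =
      ∫⁻ t in Ioc (0 : ℝ) 1, ∫⁻ y in unitCube d, ‖Torus.fderiv f (x + proj (t • y))‖ₑ := by
    refine lintegral_lintegral_swap ?_
    have hc : Continuous fun z : EuclideanSpace ℝ d × ℝ => Torus.fderiv f (x + proj (z.2 • z.1)) :=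
      hDc.comp (continuous_const.add (continuous_proj.comp (continuous_snd.smul continuous_fst)))
    exact hc.measurable.enorm.aemeasurable
  -- step 3: the scaled-cube estimate and `∫₀¹ t^{-d/q} dt = q/(q-d)`
  have h3 : ∫⁻ t in Ioc (0 : ℝ) 1, ∫⁻ y in unitCube d, ‖Torus.fderiv f (x + proj (t • y))‖ₑ ≤
      ∫⁻ t in Ioc (0 : ℝ) 1, ENNReal.ofReal (t ^ r) * N :=
    setLIntegral_mono' measurableSet_Ioc fun t ht => setLIntegral_enorm_fderiv_comp_smul_le hf hq1 x ht.1 ht.2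
  have h4 : ∫⁻ t in Ioc (0 : ℝ) 1, ENNReal.ofReal (t ^ r) * N = ENNReal.ofReal (q / (q - n)) * N := by
    have hm : Measurable fun t : ℝ => ENNReal.ofReal (t ^ r) :=
      ENNReal.measurable_ofReal.comp (measurable_id.pow_const r)
    rw [lintegral_mul_const _ hm]
    congr 1
    have hint : IntegrableOn (fun t : ℝ => t ^ r) (Ioc 0 1) volume :=
      (intervalIntegral.intervalIntegrable_rpow' hr1 (a := 0) (b := 1)).1
    have hnn : 0 ≤ᵐ[volume.restrict (Ioc (0 : ℝ) 1)] fun t : ℝ => t ^ r :=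
      (ae_restrict_iff' measurableSet_Ioc).2 (Eventually.of_forall fun t ht => Real.rpow_nonneg ht.1.le r)
    rw [← ofReal_integral_eq_lintegral_ofReal hint hnn, ← intervalIntegral.integral_of_le zero_le_one,
      integral_rpow (Or.inl hr1), Real.one_rpow, Real.zero_rpow (by linarith), sub_zero]
    congr 1
    rw [hr]
    field_simp
    ring
  calc ‖f x - ∫ z, f z‖ₑ ≤ _ := h1
    _ = (n : ℝ≥0∞) * ∫⁻ t in Ioc (0 : ℝ) 1, ∫⁻ y in unitCube d, ‖Torus.fderiv f (x + proj (t • y))‖ₑ := by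
        rw [hswap]
    _ ≤ (n : ℝ≥0∞) * ∫⁻ t in Ioc (0 : ℝ) 1, ENNReal.ofReal (t ^ r) * N := mul_le_mul' le_rfl h3
    _ = (n : ℝ≥0∞) * ENNReal.ofReal (q / (q - n)) * N := by rw [h4, mul_assoc]

/-- **Morrey's inequality for zero-mean maps**: `‖f x‖ ≤ d · q/(q-d) · ‖Df‖_{L^q(T^d)}` for every
`x`, when `∫ f = 0` and `q > d`, `q ≥ 1`. [folklore] -/
theorem enorm_le_of_hasZeroMean {f : UnitAddTorus d → F} (hf : IsContDiff 1 f) (h0 : HasZeroMean f)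
    {q : ℝ} (hq1 : 1 ≤ q) (hq : (Fintype.card d : ℝ) < q) (x : UnitAddTorus d) :
    ‖f x‖ₑ ≤ (Fintype.card d : ℝ≥0∞) * ENNReal.ofReal (q / (q - Fintype.card d)) *
      eLpNorm (fun z => ‖Torus.fderiv f z‖) (ENNReal.ofReal q) volume := by
  have h := enorm_sub_integral_le hf hq1 hq x
  rwa [show (∫ z, f z) = 0 from h0, sub_zero] at h

end Morrey

end Torus

end Literature.Analysis.FunctionSpaces
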